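import Literature.NumberTheory.Rogawski1990.ArchInnerTransferCongruence   -- ★ FILE 2 (T-d): `archStableOrbitalIntegral_transport_archCongr` (Φ^st under `g ↦ TgT⁻¹` with transported measures)
import Literature.NumberTheory.Rogawski1990.KottwitzSignArchTorus         -- ★ p05 (g11): `archStableOrbitalIntegral_classWeight_mul`; brings ★ `kottwitzSignAt`∕`kottwitzSignArch(Weight)`, ★ `archKappaOrbitalIntegral`
import HarnessLib

/-!
# The archimedean congruence transport, SIGN half: the Kottwitz signs `e_w`, `e_∞` and the SIGNED stable orbital sums `Φ^{st,e}(γ, f_∞)` on `U(H)(L ⊗ ℝ)` are invariant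
# under `g ↦ T g T⁻¹ : U(H₂)(L ⊗ ℝ) ≃ₜ* U(H)(L ⊗ ℝ)` for `(c⊗1)(T)ᵀ (H⊗1) T = H₂⊗1` (ROAD-Sd (T-d), FILE 3; Rogawski 1990 §4.1 (4.1.2) p. 39, §8.2 p. 117, §14.4 p. 237)

Topic `NumberTheory/Rogawski1990`; namespace `Literature.NumberTheory.Rogawski1990`.  THEOREMS ONLY (no `def`, no instance, no notation, no axiom, no named fact, no `sorry`).  Cell
`pub/hodgecm-mathlib`, ENGINE T1 (crux H413 = `stmt-HodgeConjecture-24833`); floor-1 preparation, count-neutral, under books rows #88 (ST-∞) ∕ #111 (S-d): ROAD-Sd item (T-d)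
«CONGRUENCE TRANSPORT» (LEAD DESK WORDS T8-39 ∕ T8-42, F0P3a-plan (g9), 2026-09-01; census `CENSUS-Td-CongruenceTransport.F0P3a-p02g10.md` 9b2b941dccae668a §4 FILE 2 §4); author F0P3a-p02 (g10).
Sequel of ★ FILE 1 `Automorphic/ArchCongruenceOrbitalTransport` and ★ FILE 2 `ArchInnerTransferCongruence`; the signs are ★ `KottwitzSignCM` (`kottwitzSignAt`, `kottwitzSignArch`,
`kottwitzSignArchWeight`, `archKappaOrbitalIntegral`), their torus readings ★ p05 `KottwitzSignArchTorus` ((J-sgn) FILE A).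

WHY.  The SIGNED archimedean stable orbital integral print writes at a split-singular `γ₀` — `Φ(γ₀, f) − Φ(γ₀′, f)` with Kottwitz signs `e(γ₀) = 1`, `e(γ₀′) = −1` [Rogawski1990 §8.2
p. 117; §4.1 (4.1.2)] — is the tree's weight-parametric ★ `archKappaOrbitalIntegral L N H w m a γ` at `w := kottwitzSignArchWeight L N H` (= ★ `archStableOrbitalIntegral` of `(w ∘ mk)·a`, ★
`archStableOrbitalIntegral_classWeight_mul`).  The (J-sgn) files evaluate the signs on the DIAGONAL torus; the closer reads them on `U(H′)(L ⊗ ℝ)` and `U(Φ₃)(L ⊗ ℝ)`.  Along a congruence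
`Φ : U(H₂)(L ⊗ ℝ) ≃ₜ* U(H)(L ⊗ ℝ)`, `g ↦ T g T⁻¹` with `(c ⊗ 1)(T)ᵀ · (H ⊗ 1) · T = H₂ ⊗ 1` (hypotheses `hΦ`, `hT`; the tree's term for `h : c(P)ᵀ H P = H₂` satisfies both, ★ FILE 1
`coe_archCongrOfEq_apply` ∕ `formCongr_map_mixedEmbedding_archFormOf_eq`), the per-place sign `e_w` is ★ `kottwitzSign_congr`-invariant (FORM-CONGRUENCE INVARIANCE of the matrix sign), hence
so are `e_∞ = ∏_w e_w`, its complex weight, and — with FILE 2 — the signed sums.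

WHAT IS PROVED (abstract `Φ`, `hΦ`, `hT`; any `N`).
* §1 `map_evalC_formCongr` — the `w`-coordinate of an archimedean congruence: `((c⊗1)(T)ᵀ A T)_w = (T_w)ᴴ A_w T_w` (`formCongr conj (T_w) (A_w)`; ★ `evalC_conjMixed`); `map_evalC_coe_archCongr`
  (`(Φ x)_w = T_w x_w T_w⁻¹`).
* §2 **`kottwitzSignAt_archCongr`**: `e_w(Φ x) = e_w(x)` (★ `kottwitzSign_congr` at `T_w`); **`kottwitzSignArch_mk_archCongr`** ∕ `kottwitzSignArch_map_archCongr`: `e_∞([Φ x]) = e_∞([x])`;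
  `kottwitzSignArchWeight_mk_archCongr` ∕ **`kottwitzSignArchWeight_comp_map_archCongr`** (`E_∞^{H} ∘ [Φ] = E_∞^{H₂}` as class weights).
* §3 **`archKappaOrbitalIntegral_transport_archCongr`**: for ANY class weight `w` on `U(H)`, `Φ^w_H(Φ γ, a ∘ Φ⁻¹; Φ_* m) = Φ^{w ∘ [Φ]}_{H₂}(γ, a; m)` (★ FILE 2 + ★
  `archStableOrbitalIntegral_classWeight_mul`); **`archKappaOrbitalIntegral_kottwitzSignArchWeight_transport_archCongr`** — THE SIGNED STABLE ORBITAL INTEGRAL IS CARRIED BY `Φ`: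
  `Φ^{st,e}_H(Φ γ, a ∘ Φ⁻¹; Φ_* m) = Φ^{st,e}_{H₂}(γ, a; m)`.
HONEST LABEL: HC_CM is proved only modulo the printed citations until rung 0 closes; this file is bookkeeping and pays nothing by itself.

## References
* [Rogawski1990] J. D. Rogawski, *Automorphic Representations of Unitary Groups in Three Variables*, Ann. of Math. Stud. 123 (1990), §4.1 (4.1.2) pp. 39–40 (the sign `e(γ)`), §8.2 p. 117
  (`e(γ₀) = 1`, `e(γ₀′) = −1`), §14.4 p. 237 («`f_v = f′_v ∘ ψ_v⁻¹`»), §1.7 p. 6.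
* [Kottwitz1983] R. E. Kottwitz, *Sign changes in harmonic analysis on reductive groups*, Trans. AMS 278 (1983), §1 (the sign `e(G)` is an invariant of the group).
* [PlatonovRapinchuk1994] V. Platonov, A. Rapinchuk, *Algebraic Groups and Number Theory* (1994), §2.3.
-/

set_option autoImplicit false

noncomputable section

open MeasureTheory NumberField NumberField.InfinitePlace NumberField.mixedEmbedding Topology
open scoped Matrix MatrixGroups

namespace Literature.NumberTheory.Rogawski1990

open Literature.MeasureTheory.Group Literature.NumberTheory.Automorphic

/-! ## §1 The `w`-coordinate of an archimedean congruence -/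

section Coordinate

variable (L : Type) [Field L] [NumberField L] [IsCMField L] {N : ℕ}

/-- **`((c⊗1)(T)ᵀ · A · T)_w = (T_w)ᴴ · A_w · T_w`**: the `w`-coordinate of an archimedean form congruence is the complex form congruence by `T_w = (T)_w` (`c ⊗ 1` is complex conjugation on
the `w`-coordinate, ★ `evalC_conjMixed`). [cite: Rogawski1990, §14.1 p. 232] [cite: PlatonovRapinchuk1994, §2.3] -/
theorem map_evalC_formCongr (T : GL (Fin N) (mixedSpace L)) (A : Matrix (Fin N) (Fin N) (mixedSpace L)) (w : {w : InfinitePlace L // IsComplex w}) :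
    (formCongr (UnitaryGroup.conjMixed (↥(maximalRealSubfield L)) L (IsCMField.complexConj L)) T A).map (UnitaryGroup.evalC L w) =
      formCongr (starRingEnd ℂ) (Matrix.GeneralLinearGroup.map (UnitaryGroup.evalC L w) T) (A.map (UnitaryGroup.evalC L w)) := by
  have hfun : (⇑(UnitaryGroup.evalC L w) ∘ ⇑(UnitaryGroup.conjMixed (↥(maximalRealSubfield L)) L (IsCMField.complexConj L))) =
      (⇑(starRingEnd ℂ) ∘ ⇑(UnitaryGroup.evalC L w)) := funext fun x =>
    UnitaryGroup.evalC_conjMixed (↥(maximalRealSubfield L)) L (IsCMField.complexConj L) (UnitaryGroup.complexConj_smul_infinitePlace L w.1) (IsCMField.complexConj_ne_one L) x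
  rw [formCongr, formCongr, Matrix.map_mul, Matrix.map_mul, Matrix.transpose_map, Matrix.map_map, hfun, ← Matrix.map_map, ← Matrix.transpose_map]
  rfl

variable {H H₂ : Matrix (Fin N) (Fin N) L} (T : GL (Fin N) (mixedSpace L))
  (Φ : UnitaryGroup.arch (↥(maximalRealSubfield L)) L (IsCMField.complexConj L) N H₂ ≃ₜ* UnitaryGroup.arch (↥(maximalRealSubfield L)) L (IsCMField.complexConj L) N H)
  (hΦ : ∀ g : UnitaryGroup.arch (↥(maximalRealSubfield L)) L (IsCMField.complexConj L) N H₂,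
    ((Φ g : UnitaryGroup.arch (↥(maximalRealSubfield L)) L (IsCMField.complexConj L) N H) : GL (Fin N) (mixedSpace L)) = T * (g : GL (Fin N) (mixedSpace L)) * T⁻¹)

include hΦ in
/-- `(Φ x)_w = T_w · x_w · T_w⁻¹` on `w`-coordinates (entrywise ring homomorphism `evalC`). [cite: Rogawski1990, §14.1 p. 232] -/
theorem map_evalC_coe_archCongr (w : {w : InfinitePlace L // IsComplex w}) (x : UnitaryGroup.arch (↥(maximalRealSubfield L)) L (IsCMField.complexConj L) N H₂) :
    (((Φ x : UnitaryGroup.arch (↥(maximalRealSubfield L)) L (IsCMField.complexConj L) N H) : GL (Fin N) (mixedSpace L)) : Matrix (Fin N) (Fin N) (mixedSpace L)).map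
        (UnitaryGroup.evalC L w) =
      ((Matrix.GeneralLinearGroup.map (UnitaryGroup.evalC L w) T : GL (Fin N) ℂ) : Matrix (Fin N) (Fin N) ℂ) *
        ((x : GL (Fin N) (mixedSpace L)) : Matrix (Fin N) (Fin N) (mixedSpace L)).map (UnitaryGroup.evalC L w) *
        (((Matrix.GeneralLinearGroup.map (UnitaryGroup.evalC L w) T)⁻¹ : GL (Fin N) ℂ) : Matrix (Fin N) (Fin N) ℂ) := by
  have h1 : (((Φ x : UnitaryGroup.arch (↥(maximalRealSubfield L)) L (IsCMField.complexConj L) N H) : GL (Fin N) (mixedSpace L)) : Matrix (Fin N) (Fin N) (mixedSpace L)).map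
        (UnitaryGroup.evalC L w) =
      ((Matrix.GeneralLinearGroup.map (UnitaryGroup.evalC L w)
        ((Φ x : UnitaryGroup.arch (↥(maximalRealSubfield L)) L (IsCMField.complexConj L) N H) : GL (Fin N) (mixedSpace L)) : GL (Fin N) ℂ) : Matrix (Fin N) (Fin N) ℂ) := rfl
  rw [h1, hΦ x, map_mul, map_mul, map_inv, Units.val_mul, Units.val_mul]
  rfl

end Coordinate

/-! ## §2 The signs `e_w`, `e_∞` under `Φ` -/

section Signs

variable (L : Type) [Field L] [NumberField L] [IsCMField L] {N : ℕ} {H H₂ : Matrix (Fin N) (Fin N) L} (T : GL (Fin N) (mixedSpace L))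
  (Φ : UnitaryGroup.arch (↥(maximalRealSubfield L)) L (IsCMField.complexConj L) N H₂ ≃ₜ* UnitaryGroup.arch (↥(maximalRealSubfield L)) L (IsCMField.complexConj L) N H)
  (hΦ : ∀ g : UnitaryGroup.arch (↥(maximalRealSubfield L)) L (IsCMField.complexConj L) N H₂,
    ((Φ g : UnitaryGroup.arch (↥(maximalRealSubfield L)) L (IsCMField.complexConj L) N H) : GL (Fin N) (mixedSpace L)) = T * (g : GL (Fin N) (mixedSpace L)) * T⁻¹)
  (hT : formCongr (UnitaryGroup.conjMixed (↥(maximalRealSubfield L)) L (IsCMField.complexConj L)) T (UnitaryGroup.archFormOf L N H) = UnitaryGroup.archFormOf L N H₂)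

include hΦ hT in
/-- **`e_w(Φ x) = e_w(x)`**: the coordinate Kottwitz sign is invariant under the congruence (★ `kottwitzSign_congr` — FORM-CONGRUENCE INVARIANCE of the matrix sign — at `T_w`, since
`(H₂)_w = (T_w)ᴴ H_w T_w` and `(Φ x)_w = T_w x_w T_w⁻¹`). [cite: Rogawski1990, §4.1 (4.1.2) p. 39; §8.2 p. 117] [cite: Kottwitz1983, §1] -/
theorem kottwitzSignAt_archCongr (w : {w : InfinitePlace L // IsComplex w}) (x : UnitaryGroup.arch (↥(maximalRealSubfield L)) L (IsCMField.complexConj L) N H₂) :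
    kottwitzSignAt L N H w (Φ x) = kottwitzSignAt L N H₂ w x := by
  unfold kottwitzSignAt
  rw [map_evalC_coe_archCongr L T Φ hΦ w x, ← hT, map_evalC_formCongr, formCongr]
  set Tw : GL (Fin N) ℂ := Matrix.GeneralLinearGroup.map (UnitaryGroup.evalC L w) T with hTw
  set xw : Matrix (Fin N) (Fin N) ℂ := (((x : GL (Fin N) (mixedSpace L)) : Matrix (Fin N) (Fin N) (mixedSpace L)).map (UnitaryGroup.evalC L w)) with hxw
  have hmat : ((Tw⁻¹ : GL (Fin N) ℂ) : Matrix (Fin N) (Fin N) ℂ) * ((Tw : Matrix (Fin N) (Fin N) ℂ) * xw * ((Tw⁻¹ : GL (Fin N) ℂ) : Matrix (Fin N) (Fin N) ℂ)) *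
      (Tw : Matrix (Fin N) (Fin N) ℂ) = xw := by
    have hgi : ((Tw⁻¹ : GL (Fin N) ℂ) : Matrix (Fin N) (Fin N) ℂ) * (Tw : Matrix (Fin N) (Fin N) ℂ) = 1 := by
      rw [← Units.val_mul, inv_mul_cancel, Units.val_one]
    calc ((Tw⁻¹ : GL (Fin N) ℂ) : Matrix (Fin N) (Fin N) ℂ) * ((Tw : Matrix (Fin N) (Fin N) ℂ) * xw * ((Tw⁻¹ : GL (Fin N) ℂ) : Matrix (Fin N) (Fin N) ℂ)) * (Tw : Matrix (Fin N) (Fin N) ℂ)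
        = (((Tw⁻¹ : GL (Fin N) ℂ) : Matrix (Fin N) (Fin N) ℂ) * (Tw : Matrix (Fin N) (Fin N) ℂ)) * xw *
            (((Tw⁻¹ : GL (Fin N) ℂ) : Matrix (Fin N) (Fin N) ℂ) * (Tw : Matrix (Fin N) (Fin N) ℂ)) := by
          simp only [Matrix.mul_assoc]
      _ = xw := by rw [hgi, Matrix.one_mul, Matrix.mul_one]
  have key := (kottwitzSign_congr (σ := starRingEnd ℂ) (H := (UnitaryGroup.archFormOf L N H).map (UnitaryGroup.evalC L w)) Tw
    ((Tw : Matrix (Fin N) (Fin N) ℂ) * xw * ((Tw⁻¹ : GL (Fin N) ℂ) : Matrix (Fin N) (Fin N) ℂ))).symm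
  rw [hmat] at key
  exact key

include hΦ hT in
/-- **`e_∞([Φ x]) = e_∞([x])`** (product over the complex places of §2's coordinate invariance; ★ `kottwitzSignArch_mk`). [cite: Rogawski1990, §4.1 (4.1.2) p. 39] [cite: Kottwitz1983, §1] -/
theorem kottwitzSignArch_mk_archCongr (x : UnitaryGroup.arch (↥(maximalRealSubfield L)) L (IsCMField.complexConj L) N H₂) :
    kottwitzSignArch L N H (ConjClasses.mk (Φ x)) = kottwitzSignArch L N H₂ (ConjClasses.mk x) := by
  rw [kottwitzSignArch_mk, kottwitzSignArch_mk]
  exact Finset.prod_congr rfl fun w _ => kottwitzSignAt_archCongr L T Φ hΦ hT w x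

include hΦ hT in
/-- The same on classes pushed along `Φ`: `e_∞(Φ_* c) = e_∞(c)`. [cite: Rogawski1990, §4.1 (4.1.2) p. 39] -/
theorem kottwitzSignArch_map_archCongr (c : ConjClasses (UnitaryGroup.arch (↥(maximalRealSubfield L)) L (IsCMField.complexConj L) N H₂)) :
    kottwitzSignArch L N H (c.map Φ.toMulEquiv.toMonoidHom) = kottwitzSignArch L N H₂ c := by
  obtain ⟨x, rfl⟩ := ConjClasses.mk_surjective c
  exact kottwitzSignArch_mk_archCongr L T Φ hΦ hT x

include hΦ hT in
/-- The complex weights: `E_∞([Φ x]) = E_∞([x])`. [cite: Rogawski1990, §4.1 (4.1.2) p. 39] -/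
theorem kottwitzSignArchWeight_mk_archCongr (x : UnitaryGroup.arch (↥(maximalRealSubfield L)) L (IsCMField.complexConj L) N H₂) :
    kottwitzSignArchWeight L N H (ConjClasses.mk (Φ x)) = kottwitzSignArchWeight L N H₂ (ConjClasses.mk x) := by
  unfold kottwitzSignArchWeight
  rw [kottwitzSignArch_mk_archCongr L T Φ hΦ hT x]

include hΦ hT in
/-- **AS CLASS WEIGHTS: `E_∞^{H} ∘ Φ_* = E_∞^{H₂}`** — the shape in which ★ `archKappaOrbitalIntegral`'s weight is transported (§3). [cite: Rogawski1990, §4.1 (4.1.2) p. 39] -/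
theorem kottwitzSignArchWeight_comp_map_archCongr :
    kottwitzSignArchWeight L N H ∘ ConjClasses.map Φ.toMulEquiv.toMonoidHom = kottwitzSignArchWeight L N H₂ := by
  funext c
  obtain ⟨x, rfl⟩ := ConjClasses.mk_surjective c
  exact kottwitzSignArchWeight_mk_archCongr L T Φ hΦ hT x

end Signs

/-! ## §3 The signed stable orbital sums under `Φ` -/

section SignedSums

variable (L : Type) [Field L] [NumberField L] [IsCMField L] {N : ℕ} {H H₂ : Matrix (Fin N) (Fin N) L} (T : GL (Fin N) (mixedSpace L))
  (Φ : UnitaryGroup.arch (↥(maximalRealSubfield L)) L (IsCMField.complexConj L) N H₂ ≃ₜ* UnitaryGroup.arch (↥(maximalRealSubfield L)) L (IsCMField.complexConj L) N H)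
  (hΦ : ∀ g : UnitaryGroup.arch (↥(maximalRealSubfield L)) L (IsCMField.complexConj L) N H₂,
    ((Φ g : UnitaryGroup.arch (↥(maximalRealSubfield L)) L (IsCMField.complexConj L) N H) : GL (Fin N) (mixedSpace L)) = T * (g : GL (Fin N) (mixedSpace L)) * T⁻¹)
  [∀ γ : UnitaryGroup.arch (↥(maximalRealSubfield L)) L (IsCMField.complexConj L) N H,
    MeasurableSpace (UnitaryGroup.arch (↥(maximalRealSubfield L)) L (IsCMField.complexConj L) N H ⧸
      Subgroup.centralizer ({γ} : Set (UnitaryGroup.arch (↥(maximalRealSubfield L)) L (IsCMField.complexConj L) N H)))]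
  [∀ γ : UnitaryGroup.arch (↥(maximalRealSubfield L)) L (IsCMField.complexConj L) N H,
    BorelSpace (UnitaryGroup.arch (↥(maximalRealSubfield L)) L (IsCMField.complexConj L) N H ⧸
      Subgroup.centralizer ({γ} : Set (UnitaryGroup.arch (↥(maximalRealSubfield L)) L (IsCMField.complexConj L) N H)))]
  [∀ γ : UnitaryGroup.arch (↥(maximalRealSubfield L)) L (IsCMField.complexConj L) N H₂,
    MeasurableSpace (UnitaryGroup.arch (↥(maximalRealSubfield L)) L (IsCMField.complexConj L) N H₂ ⧸
      Subgroup.centralizer ({γ} : Set (UnitaryGroup.arch (↥(maximalRealSubfield L)) L (IsCMField.complexConj L) N H₂)))]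
  [∀ γ : UnitaryGroup.arch (↥(maximalRealSubfield L)) L (IsCMField.complexConj L) N H₂,
    BorelSpace (UnitaryGroup.arch (↥(maximalRealSubfield L)) L (IsCMField.complexConj L) N H₂ ⧸
      Subgroup.centralizer ({γ} : Set (UnitaryGroup.arch (↥(maximalRealSubfield L)) L (IsCMField.complexConj L) N H₂)))]

include hΦ in
/-- **WEIGHTED STABLE ORBITAL SUMS ARE CARRIED BY `Φ`**: for ANY class weight `w` on `U(H)(L ⊗ ℝ)`, `Φ^w_H(Φ γ, a ∘ Φ⁻¹; Φ_* m) = Φ^{w ∘ Φ_*}_{H₂}(γ, a; m)` (the weighted sum is the stable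
orbital integral of `(w ∘ [·])·a`, ★ `archStableOrbitalIntegral_classWeight_mul`; then ★ FILE 2 `archStableOrbitalIntegral_transport_archCongr`). [cite: Rogawski1990, §4.1 (4.1.2) p. 39; §14.4 p. 237] -/
theorem archKappaOrbitalIntegral_transport_archCongr (w : ConjClasses (UnitaryGroup.arch (↥(maximalRealSubfield L)) L (IsCMField.complexConj L) N H) → ℂ)
    (m : OrbitalMeasureFamily (UnitaryGroup.arch (↥(maximalRealSubfield L)) L (IsCMField.complexConj L) N H₂))
    (a : UnitaryGroup.arch (↥(maximalRealSubfield L)) L (IsCMField.complexConj L) N H₂ → ℂ)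
    (γ : UnitaryGroup.arch (↥(maximalRealSubfield L)) L (IsCMField.complexConj L) N H₂) :
    archKappaOrbitalIntegral L N H w (m.transport Φ.toMulEquiv Φ.continuous Φ.symm.continuous) (a ∘ Φ.symm) (Φ γ) =
      archKappaOrbitalIntegral L N H₂ (w ∘ ConjClasses.map Φ.toMulEquiv.toMonoidHom) m a γ := by
  rw [← archStableOrbitalIntegral_classWeight_mul, ← archStableOrbitalIntegral_classWeight_mul]
  have hfun : (fun y : UnitaryGroup.arch (↥(maximalRealSubfield L)) L (IsCMField.complexConj L) N H => w (ConjClasses.mk y) * (a ∘ Φ.symm) y) =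
      (fun x : UnitaryGroup.arch (↥(maximalRealSubfield L)) L (IsCMField.complexConj L) N H₂ =>
        (w ∘ ConjClasses.map Φ.toMulEquiv.toMonoidHom) (ConjClasses.mk x) * a x) ∘ Φ.symm := by
    funext y
    simp only [Function.comp_apply]
    congr 2
    show ConjClasses.mk y = ConjClasses.mk (Φ.toMulEquiv (Φ.symm y))
    rw [show Φ.toMulEquiv (Φ.symm y) = Φ (Φ.symm y) from rfl, ContinuousMulEquiv.apply_symm_apply]
  rw [hfun]
  exact archStableOrbitalIntegral_transport_archCongr L T Φ hΦ m _ γ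

variable (hT : formCongr (UnitaryGroup.conjMixed (↥(maximalRealSubfield L)) L (IsCMField.complexConj L)) T (UnitaryGroup.archFormOf L N H) = UnitaryGroup.archFormOf L N H₂)

include hΦ hT in
/-- **THE SIGNED STABLE ORBITAL INTEGRAL `Φ^{st,e}` IS CARRIED BY `Φ`**: `Φ^{st,e}_H(Φ γ, a ∘ Φ⁻¹; Φ_* m) = Φ^{st,e}_{H₂}(γ, a; m)` — print's «`f_v = f′_v ∘ ψ_v⁻¹`» with compatible measures for
the signed sums of (4.1.2) (the previous lemma at `w := E_∞^H`, and `E_∞^H ∘ Φ_* = E_∞^{H₂}`). [cite: Rogawski1990, §4.1 (4.1.2) p. 39; §8.2 p. 117; §14.4 p. 237] -/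
theorem archKappaOrbitalIntegral_kottwitzSignArchWeight_transport_archCongr
    (m : OrbitalMeasureFamily (UnitaryGroup.arch (↥(maximalRealSubfield L)) L (IsCMField.complexConj L) N H₂))
    (a : UnitaryGroup.arch (↥(maximalRealSubfield L)) L (IsCMField.complexConj L) N H₂ → ℂ)
    (γ : UnitaryGroup.arch (↥(maximalRealSubfield L)) L (IsCMField.complexConj L) N H₂) :
    archKappaOrbitalIntegral L N H (kottwitzSignArchWeight L N H) (m.transport Φ.toMulEquiv Φ.continuous Φ.symm.continuous) (a ∘ Φ.symm) (Φ γ) =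
      archKappaOrbitalIntegral L N H₂ (kottwitzSignArchWeight L N H₂) m a γ := by
  rw [archKappaOrbitalIntegral_transport_archCongr L T Φ hΦ, kottwitzSignArchWeight_comp_map_archCongr L T Φ hΦ hT]

end SignedSums

end Literature.NumberTheory.Rogawski1990

end
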